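import Mathlib
import HarnessLib

/-!
# K1-B meridian package VI — images of polynomial maps and linear subspaces are irreducible; an irreducible
# set inside a hypersurface arrangement lies in one hypersurface (route `SignSymmetricPowers`, item
# stmt-HodgeConjecture-19716)

Helper file (`--supports stmt-HodgeConjecture-19716`) for the open stubs GEN / LINK-G of the K1-B line `andre-zariski`:
steps H2(b2′) ("images of polynomial parametrisations are irreducible") and §3a of memo K1B-LINKF-PLAN-g23 ("SAME
COMPONENT for two one-node-at-`p` centres: the LINEAR space `N_p` of forms singular at `p` is irreducible, contained in
`V(D_M) = ⋃ V(hⱼ)`, hence in one `V(hⱼ)`").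

* **`vanishingIdeal_range_eq_ker`**, **`isPrime_vanishingIdeal_range`** — the vanishing ideal of the image of a
  polynomial map `ℂ^τ → ℂ^σ` is the kernel of `q ↦ q ∘ Ψ`, hence prime;
* **`isPrime_vanishingIdeal_range_linearMap`** — in particular the image of a linear map (a linear subspace) has
  prime vanishing ideal;
* **`exists_subset_zeroLocus_of_isPrime`** — a set with prime vanishing ideal contained in `⋃ⱼ V(hⱼ)` lies in one
  `V(h_{j₀})` (prime avoidance).
Combined with package I (`exists_unique_factor_pencil`: at a one-node centre exactly one factor vanishes) this
gives: all one-node centres with node at the same point `p` lie on the SAME prime factor of `D_M` — the input of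
F-MC for the Π- and L-type conjugacies of LINK-G; combined with package V it is the frame of G2.

Sorry-free; axioms standard; no definition, no named fact.

## References

* [Hartshorne1977] R. Hartshorne, Algebraic Geometry, I Prop. 1.13, I Ex. 1.1.3.
-/

noncomputable section

set_option linter.dupNamespace false

open MvPolynomial

namespace Summit.HodgeConjecture.HodgeConjecture.Theorems.SignSymmetricPowersMeridianIrreducible

variable {σ τ : Type*}

/-- **The vanishing ideal of the image of a polynomial map `Ψ : ℂ^τ → ℂ^σ` is the kernel of `q ↦ q ∘ Ψ`**
(`aeval Ψ`): a polynomial vanishes on the image iff its composite with `Ψ` vanishes identically, i.e. is the zero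
polynomial (`MvPolynomial.funext` over the infinite field `ℂ`). [cite: Hartshorne1977, I Prop. 1.13] -/
theorem vanishingIdeal_range_eq_ker (Ψ : σ → MvPolynomial τ ℂ) :
    vanishingIdeal ℂ (Set.range fun x : τ → ℂ => fun i : σ => MvPolynomial.aeval x (Ψ i)) =
      RingHom.ker (MvPolynomial.aeval Ψ).toRingHom := by
  ext q
  rw [mem_vanishingIdeal_iff, RingHom.mem_ker]
  have hcomp : ∀ x : τ → ℂ, MvPolynomial.aeval (fun i : σ => MvPolynomial.aeval x (Ψ i)) q =
      MvPolynomial.aeval x (MvPolynomial.aeval Ψ q) := fun x =>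
    (comp_aeval_apply (f := Ψ) (MvPolynomial.aeval x) q).symm
  constructor
  · intro h
    apply MvPolynomial.funext
    intro x
    rw [map_zero, ← coe_aeval_eq_eval]
    change MvPolynomial.aeval x ((MvPolynomial.aeval Ψ) q) = 0
    rw [← hcomp]
    exact h _ ⟨x, rfl⟩
  · rintro h x ⟨y, rfl⟩
    change MvPolynomial.aeval (fun i : σ => MvPolynomial.aeval y (Ψ i)) q = 0
    rw [hcomp]
    change MvPolynomial.aeval y ((MvPolynomial.aeval Ψ).toRingHom q) = 0
    rw [h, map_zero]

/-- **The image of a polynomial map is irreducible**: its vanishing ideal is prime (kernel of a ring map into the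
domain `ℂ[b]`).  This covers linear subspaces and the incidence strata of the component count G2 (memo
K1B-GEN-STUBPLAN-g23 H2(b2′): images of polynomial parametrisations). [cite: Hartshorne1977, I Prop. 1.13 and I Ex. 1.1.3] -/
theorem isPrime_vanishingIdeal_range (Ψ : σ → MvPolynomial τ ℂ) :
    (vanishingIdeal ℂ (Set.range fun x : τ → ℂ => fun i : σ => MvPolynomial.aeval x (Ψ i))).IsPrime := by
  rw [vanishingIdeal_range_eq_ker]
  exact RingHom.ker_isPrime _

/-- **A linear subspace is irreducible**: the vanishing ideal of the image of a `ℂ`-linear map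
`φ : ℂ^τ → ℂ^σ` (`τ` finite) is prime — `φ` is the polynomial map with linear coordinates `Σ_j φ(e_j)_i X_j`.
[cite: Hartshorne1977, I Ex. 1.1.3] -/
theorem isPrime_vanishingIdeal_range_linearMap [Fintype τ] [DecidableEq τ] (φ : (τ → ℂ) →ₗ[ℂ] (σ → ℂ)) :
    (vanishingIdeal ℂ (Set.range φ)).IsPrime := by
  have hrange : Set.range (φ : (τ → ℂ) → (σ → ℂ)) =
      Set.range fun x : τ → ℂ => fun i : σ =>
        MvPolynomial.aeval x (∑ j : τ, MvPolynomial.C (φ (Pi.single j 1) i) * MvPolynomial.X j) := by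
    congr 1
    funext x
    funext i
    have hx : x = ∑ j : τ, x j • (Pi.single j (1 : ℂ) : τ → ℂ) := by
      funext j'
      simp [Finset.sum_apply, Pi.single_apply]
    conv_lhs => rw [hx]
    simp only [map_sum, map_smul, Finset.sum_apply, Pi.smul_apply, smul_eq_mul, map_mul, aeval_C,
      aeval_X, Algebra.algebraMap_self, RingHom.id_apply]
    exact Finset.sum_congr rfl fun j _ => mul_comm _ _
  rw [hrange]
  exact isPrime_vanishingIdeal_range _

/-- **An irreducible set inside a hypersurface arrangement lies in one of the hypersurfaces**: if the vanishing
ideal of `S ⊆ ℂ^σ` is prime and `S ⊆ ⋃ⱼ V(hⱼ)` for finitely many polynomials `hⱼ`, then `S ⊆ V(h_{j₀})` for some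
`j₀` (`∏ hⱼ` vanishes on `S`, prime avoidance).  Used for the linear space `N_p` of forms singular at a point `p`
inside the restricted discriminant (memo K1B-LINKF-PLAN-g23 §3a: "same component for two one-node centres").
[cite: Hartshorne1977, I Prop. 1.13] -/
theorem exists_subset_zeroLocus_of_isPrime {m : ℕ} {S : Set (σ → ℂ)} (hS : (vanishingIdeal ℂ S).IsPrime)
    (h : Fin m → MvPolynomial σ ℂ) (hsub : ∀ x ∈ S, ∃ j, MvPolynomial.aeval x (h j) = 0) :
    ∃ j₀, ∀ x ∈ S, MvPolynomial.aeval x (h j₀) = 0 := by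
  classical
  by_cases hm : m = 0
  · subst hm
    by_cases hS0 : S = ∅
    · subst hS0
      exact absurd (hS.ne_top) (by rw [vanishingIdeal_empty]; exact fun h => h rfl)
    · obtain ⟨x, hx⟩ := Set.nonempty_iff_ne_empty.2 hS0
      obtain ⟨j, -⟩ := hsub x hx
      exact j.elim0
  · have hprod : (∏ j, h j) ∈ vanishingIdeal ℂ S := by
      rw [mem_vanishingIdeal_iff]
      intro x hx
      obtain ⟨j, hj⟩ := hsub x hx
      rw [map_prod]
      exact Finset.prod_eq_zero (Finset.mem_univ j) hj
    haveI := hS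
    obtain ⟨j₀, -, hj₀⟩ := Ideal.IsPrime.prod_mem_iff.1 hprod
    exact ⟨j₀, fun x hx => (mem_vanishingIdeal_iff.1 hj₀) x hx⟩


/-- **A linear subspace is irreducible** (submodule form): the vanishing ideal of (the carrier of) a submodule
`K ≤ ℂ^σ`, `σ` finite, is prime. [cite: Hartshorne1977, I Ex. 1.1.3] -/
theorem isPrime_vanishingIdeal_submodule [Fintype σ] (K : Submodule ℂ (σ → ℂ)) :
    (vanishingIdeal ℂ (K : Set (σ → ℂ))).IsPrime := by
  classical
  let b := Module.finBasis ℂ K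
  let φ : (Fin (Module.finrank ℂ K) → ℂ) →ₗ[ℂ] (σ → ℂ) := K.subtype ∘ₗ (b.equivFun.symm : _ →ₗ[ℂ] K)
  have hrange : Set.range φ = (K : Set (σ → ℂ)) := by
    ext y
    constructor
    · rintro ⟨x, rfl⟩
      exact (b.equivFun.symm x).2
    · intro hy
      exact ⟨b.equivFun ⟨y, hy⟩, by simp [φ]⟩
  rw [← hrange]
  exact isPrime_vanishingIdeal_range_linearMap φ

/-- **A linear subspace inside a hypersurface arrangement lies in one hypersurface.** [cite: Hartshorne1977, I Prop. 1.13] -/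
theorem exists_submodule_subset_zeroLocus [Fintype σ] {m : ℕ} (K : Submodule ℂ (σ → ℂ))
    (h : Fin m → MvPolynomial σ ℂ) (hsub : ∀ x ∈ (K : Set (σ → ℂ)), ∃ j, MvPolynomial.aeval x (h j) = 0) :
    ∃ j₀, ∀ x ∈ (K : Set (σ → ℂ)), MvPolynomial.aeval x (h j₀) = 0 :=
  exists_subset_zeroLocus_of_isPrime (isPrime_vanishingIdeal_submodule K) h hsub

end Summit.HodgeConjecture.HodgeConjecture.Theorems.SignSymmetricPowersMeridianIrreducible

end
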